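import Summits.Ventures.HodgeRepro2.T5SU11LegendreTuran
import Summits.Ventures.HodgeRepro2.T5SU11LegendreZeros
import Summits.Ventures.HodgeRepro2.T5SU11LegendreInterlacing
import Summits.Ventures.HodgeRepro2.T5SU11JacobiEvenCumulants
import Summits.Ventures.HodgeRepro2.T5SU11LegendreLaplaceHeineUniform
import Summits.Ventures.HodgeRepro2.T5SU11LegendreDerivativeSum
import Summits.Ventures.HodgeRepro2.T5SU11LegendreGeneratingCircle

/-!
# The Legendre chapter, part III, in one place: rows 399–405 indexed under uniform names

A third summary module (the first two, `T5SU11LegendreSummary` and `T5SU11LegendreSummaryII`, cover rows 363–397):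
the headline statements of rows 399–405 restated and proved by reference — Turán's inequality on `[−1, 1]` with its
strict form, its equality cases, the sign law on the whole line and the Turán inequality of the derivatives (399),
the zeros of `P_n` (400), the interlacing of the zeros of `P_n` and `P_{n+1}` (403), Markov's bound
`|P'_n| ≤ n(n+1)/2` with `P'_n(±1)` (404), the generating function on `[−1, 1]` and on the circle (405), all
cumulants of the phase at the even parameters (401), and the Laplace–Heine asymptotic uniformly on `t ≥ t₀` (402).
Nothing is claimed about (N).

Blind lane: Mathlib + the HodgeRepro2 prefix only; no sorry; axioms ⊆ {propext, Classical.choice,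
Quot.sound}.
-/

namespace Summit.Ventures.HodgeRepro2.T5SU11LegendreSummaryIII

open MeasureTheory Metric Set Filter Topology Finset Polynomial
open T5SU11Unimodular T5SU11Cartan T5BergmanCoefficient T5SU11SphericalFunction T5SU11SphericalLegendreAll
  T5SU11JacobiPhaseLawEven T5SU11JacobiEvenProduct T5SU11LegendreTuran T5SU11LegendreZeros
  T5SU11LegendreInterlacing T5SU11JacobiEvenCumulants T5SU11LegendreLaplaceHeineUniform
  T5SU11LegendreDerivativeSum T5SU11LegendreGeneratingCircle T5SU11LegendreGenerating
open scoped Real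

/-- 399: **Turán's inequality** `P_n(x) P_{n+2}(x) ≤ P_{n+1}(x)²` on `[−1, 1]`. -/
theorem turan_inequality (n : ℕ) {x : ℝ} (hx : x ∈ Icc (-1 : ℝ) 1) : legP n x * legP (n + 2) x ≤ legP (n + 1) x ^ 2 :=
  turan n hx

/-- 399: Turán's inequality is strict on `(−1, 1)`. -/
theorem turan_strict (n : ℕ) {x : ℝ} (hx : x ∈ Ioo (-1 : ℝ) 1) : legP n x * legP (n + 2) x < legP (n + 1) x ^ 2 :=
  turan_lt n hx

/-- 399: equality at `x = ±1`. -/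
theorem turan_equality (n : ℕ) :
    legP n 1 * legP (n + 2) 1 = legP (n + 1) 1 ^ 2 ∧ legP n (-1) * legP (n + 2) (-1) = legP (n + 1) (-1) ^ 2 :=
  ⟨turan_eq_one n, turan_eq_neg_one n⟩

/-- 399: the sign law on the whole line, `0 ≤ (1 − x²)(P_{n+1}(x)² − P_n(x) P_{n+2}(x))`. -/
theorem turan_sign_law (n : ℕ) (x : ℝ) : 0 ≤ (1 - x ^ 2) * (legP (n + 1) x ^ 2 - legP n x * legP (n + 2) x) :=
  one_sub_sq_mul_turan_nonneg n x

/-- 399: Turán's inequality for the `j`-th derivatives (the ultraspherical polynomials). -/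
theorem turan_derivatives (n : ℕ) {j : ℕ} (hj : j ≤ n + 1) {x : ℝ} (hx : x ∈ Icc (-1 : ℝ) 1) :
    (legD n j).eval x * (legD (n + 2) j).eval x ≤ (legD (n + 1) j).eval x ^ 2 :=
  turan_derivative n hj hx

/-- 399: the identity chain behind Turán's inequality,
`((n+1)(n+2) − (j+1) j) · T_{j+1} = (1 − X²) · T_{j+2} + 2(j+1) · (P_{n+1}^{(j+1)})²`. -/
theorem turan_chain (n j : ℕ) :
    (((n : ℝ[X]) + 1) * ((n : ℝ[X]) + 2) - ((j : ℝ[X]) + 1) * (j : ℝ[X])) * turanD n (j + 1)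
      = (1 - X ^ 2) * turanD n (j + 2) + 2 * ((j : ℝ[X]) + 1) * legD (n + 1) (j + 1) ^ 2 :=
  turanD_chain n j

/-- 400: **the zeros of `P_n`** — an `n`-element set `s ⊂ (−1, 1)` with `P_n(x) = 0 ↔ x ∈ s`, every zero simple. -/
theorem zeros (n : ℕ) :
    ∃ s : Finset ℝ, s.card = n ∧ (∀ r ∈ s, r ∈ Ioo (-1 : ℝ) 1) ∧ (∀ x, legP n x = 0 ↔ x ∈ s)
      ∧ ∀ r ∈ s, rootMultiplicity r (legPoly n) = 1 :=
  legendre_zeros n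

/-- 400: `P_n(x) ≠ 0` for `|x| ≥ 1`. -/
theorem ne_zero_outside (n : ℕ) {x : ℝ} (hx : 1 ≤ |x|) : legP n x ≠ 0 :=
  legP_ne_zero_of_one_le_abs n hx

/-- 400: `legPoly n` has `n` roots, all simple. -/
theorem card_roots (n : ℕ) : Multiset.card (legPoly n).roots = n ∧ (legPoly n).roots.Nodup :=
  card_roots_legPoly n

/-- 403: **the zeros of `P_n` and `P_{n+1}` interlace**: `r i < s i < r (i + 1)`. -/
theorem zeros_interlace (n : ℕ) :
    ∃ (r : Fin (n + 1) → ℝ) (s : Fin n → ℝ), StrictMono r ∧ StrictMono s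
      ∧ (∀ x, legP (n + 1) x = 0 ↔ ∃ i, r i = x) ∧ (∀ x, legP n x = 0 ↔ ∃ i, s i = x)
      ∧ ∀ i : Fin n, r (Fin.castSucc i) < s i ∧ s i < r i.succ :=
  interlacing n

/-- 403: between two consecutive zeros of `P_{n+1}` lies a zero of `P_n`. -/
theorem exists_zero_between (n : ℕ) {a b : ℝ} (hab : a < b) (ha : legP (n + 1) a = 0) (hb : legP (n + 1) b = 0)
    (hno : ∀ x ∈ Ioo a b, legP (n + 1) x ≠ 0) : ∃ c ∈ Ioo a b, legP n c = 0 :=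
  exists_root_legP_between n hab ha hb hno

/-- 403: `P_n(x) P'_{n+1}(x) − P_{n+1}(x) P'_n(x) > 0` for every real `x`. -/
theorem christoffel_darboux_pos (n : ℕ) (x : ℝ) : 0 < legP n x * legQ (n + 1) x - legP (n + 1) x * legQ n x :=
  legP_mul_legQ_succ_sub_pos' n x

/-- 404: **Markov's bound** `|P'_n(x)| ≤ n(n + 1)/2 = P'_n(1)` on `[−1, 1]`. -/
theorem markov_bound (n : ℕ) {x : ℝ} (hx : x ∈ Icc (-1 : ℝ) 1) : |legQ n x| ≤ (n : ℝ) * (n + 1) / 2 :=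
  abs_legQ_le n hx

/-- 404: `P'_n(1) = n(n + 1)/2` and `P'_n(−1) = (−1)^{n+1} n(n + 1)/2`. -/
theorem derivative_at_endpoints (n : ℕ) :
    legQ n 1 = (n : ℝ) * (n + 1) / 2 ∧ legQ n (-1) = (-1) ^ (n + 1) * ((n : ℝ) * (n + 1) / 2) :=
  ⟨legQ_one_eq n, legQ_neg_one_eq n⟩

/-- 404: the telescoped derivatives `P'_{2m} = Σ_{j<m} (4j + 3) P_{2j+1}`, `P'_{2m+1} = Σ_{j≤m} (4j + 1) P_{2j}`. -/
theorem derivative_expansion (m : ℕ) (x : ℝ) :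
    legQ (2 * m) x = ∑ j ∈ range m, (4 * (j : ℝ) + 3) * legP (2 * j + 1) x
      ∧ legQ (2 * m + 1) x = ∑ j ∈ range (m + 1), (4 * (j : ℝ) + 1) * legP (2 * j) x :=
  ⟨legQ_even_eq_sum m x, legQ_odd_eq_sum m x⟩

/-- 405: **the generating function on `[−1, 1]`**, `Σ_n P_n(x) rⁿ = 1/√(1 − 2xr + r²)` for `|r| < 1`. -/
theorem generating_function_interval {x r : ℝ} (hx : x ∈ Icc (-1 : ℝ) 1) (hr : |r| < 1) :
    ∑' n, legP n x * r ^ n = 1 / Real.sqrt (1 - 2 * x * r + r ^ 2) :=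
  tsum_legP_mul_pow_of_mem_Icc hx hr

/-- 405: **the generating function on the circle**, `Σ_n P_n(cos θ) rⁿ = 1/√(1 − 2r cos θ + r²)`. -/
theorem generating_function_circle (θ : ℝ) {r : ℝ} (hr : |r| < 1) :
    ∑' n, legP n (Real.cos θ) * r ^ n = 1 / Real.sqrt (1 - 2 * r * Real.cos θ + r ^ 2) :=
  tsum_legP_cos_mul_pow θ hr

/-- 405: `S_x(r)² (1 − 2xr + r²) = 1` under absolute convergence alone. -/
theorem generating_function_square {x r : ℝ} (h : Summable fun n => ‖legP n x * r ^ n‖) :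
    legGen x r ^ 2 * (1 - 2 * x * r + r ^ 2) = 1 :=
  legGen_sq_mul_of_summable h

section measure

variable [MeasurableSpace Circle] [BorelSpace Circle]

/-- 401: **all cumulants of the phase at `λ = 2n + 2`**,
`κ_{m+1}(log|a|) = m! · [1/(k − 2)^{m+1} + Σ_{i<n} (1/(k − 4 − 2i)^{m+1} − 1/(k + 2i)^{m+1})]` for `k > 2n + 2`. -/
theorem cumulants_even (n : ℕ) {k : ℝ} (hk : 2 * (n : ℝ) + 2 < k) (m : ℕ) :
    cumulantEven n k (m + 1) = (m.factorial : ℝ) * cumProd n k (m + 1) :=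
  cumulantEven_succ_eq n hk m

/-- 401: the first two cumulants are row 381's mean and variance of the phase. -/
theorem cumulants_even_one_two (n : ℕ) {k : ℝ} (hk : 2 * (n : ℝ) + 2 < k) :
    cumulantEven n k 1 = meanProd n k ∧ cumulantEven n k 2 = varProd n k :=
  ⟨cumulantEven_one n hk, cumulantEven_two n hk⟩

/-- 401: every cumulant of the phase at the even parameters is positive. -/
theorem cumulants_even_pos (n : ℕ) {k : ℝ} (hk : 2 * (n : ℝ) + 2 < k) (m : ℕ) : 0 < cumulantEven n k (m + 1) :=
  cumulantEven_succ_pos n hk m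

/-- 402: **the Laplace–Heine asymptotic uniformly on `t ≥ t₀ > 0`, on the group**:
`√n e^{−2nt} φ_{2n+2}(a_t) → 1/√(π(1 − e^{−4t}))` uniformly on `[t₀, ∞)`. -/
theorem sph_laplace_heine_uniform {t₀ : ℝ} (ht₀ : 0 < t₀) :
    TendstoUniformlyOn
      (fun (n : ℕ) (t : ℝ) => Real.sqrt n * (Real.exp (-(2 * (n : ℝ)) * t) * sph (2 * (n : ℝ) + 2) (hyp t)))
      (fun t => 1 / Real.sqrt (Real.pi * (1 - Real.exp (-(4 * t))))) atTop (Ici t₀) :=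
  tendstoUniformlyOn_sph_laplace_heine ht₀

end measure

/-- 402: the Laplace–Heine asymptotic uniformly on `t ≥ t₀ > 0` for the Legendre polynomials. -/
theorem laplace_heine_uniform {t₀ : ℝ} (ht₀ : 0 < t₀) :
    TendstoUniformlyOn
      (fun (n : ℕ) (t : ℝ) => Real.sqrt n * (Real.exp (-(2 * (n : ℝ)) * t) * legP n (Real.cosh (2 * t))))
      (fun t => 1 / Real.sqrt (Real.pi * (1 - Real.exp (-(4 * t))))) atTop (Ici t₀) :=
  tendstoUniformlyOn_laplace_heine ht₀

/-- 402: the explicit uniform error `|√n e^{−2nt} P_n(cosh 2t) − 1/√(π(1 − e^{−4t}))| ≤ E'_n(e^{−4t₀})`. -/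
theorem laplace_heine_uniform_error {t₀ : ℝ} (ht₀ : 0 < t₀) {t : ℝ} (ht : t₀ ≤ t) {n : ℕ} (hn : 1 ≤ n) :
    |Real.sqrt n * (Real.exp (-(2 * (n : ℝ)) * t) * legP n (Real.cosh (2 * t)))
        - 1 / Real.sqrt (Real.pi * (1 - Real.exp (-(4 * t))))| ≤ uniformErr' (Real.exp (-(4 * t₀))) n :=
  abs_sqrt_mul_sub_le ht₀ ht hn

end Summit.Ventures.HodgeRepro2.T5SU11LegendreSummaryIII
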